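import Summits.KontsevichZagierPeriods.KontsevichZagierPeriods.Theses.DimensionBudget

/-!
# `Assembly` (stmt-KontsevichZagierPeriods-3755, route DimensionBudget) — proof

The route's assembly item `BudgetThesis → KontsevichZagierPeriods` is its gate-verified deciding
theorem `Summit.KontsevichZagierPeriods.KontsevichZagierPeriods.Theses.DimensionBudget.closes` read
as an implication (binders reordered / dropped as needed); the antecedents are the route's cruxes
and are NOT discharged here: the theorem is the implication, nothing more. (Lead c10 of crux
stmt-KontsevichZagierPeriods-9129, banking.) No definitions are introduced.

References: M. Kontsevich, D. Zagier, *Periods* (2001), §1.2, Conjecture 1.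
-/

namespace Summit.KontsevichZagierPeriods.DimensionBudget

/-- **Assembly of route DimensionBudget** (stmt-KontsevichZagierPeriods-3755): `BudgetThesis →
KontsevichZagierPeriods` — the cruxes imply the summit, by the route's deciding theorem `closes`.
[Kontsevich–Zagier 2001, §1.2] [folklore] -/
theorem assembly_proof :
    Summit.KontsevichZagierPeriods.KontsevichZagierPeriods.Theses.DimensionBudget.Assembly :=
  fun h₁ =>
    Summit.KontsevichZagierPeriods.KontsevichZagierPeriods.Theses.DimensionBudget.closes h₁

end Summit.KontsevichZagierPeriods.DimensionBudget
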